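import Literature.AlgebraicGeometry.Motives.VarietiesGeometricallyIntegralProofs
import Mathlib.RingTheory.Smooth.Flat
import Mathlib.RingTheory.Flat.Basic
import Mathlib.RingTheory.LocalProperties.Reduced
import Mathlib.RingTheory.Localization.FractionRing
import Mathlib.FieldTheory.PurelyInseparable.Basic
import Mathlib.RingTheory.Localization.Integral
import HarnessLib

/-!
# Commutative algebra for Temkin's §4: reduced smooth covers, purely inseparable rigidity, generic fibres

Topic: `Literature/AlgebraicGeometry/Resolution`. Pieces of commutative algebra used tacitly
in §4 of M. Temkin, *Inseparable local uniformization*, J. Algebra 373 (2013) 65–119 =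
arXiv:0804.1554v3, whenever a smooth-equivalence (Definition 2.8.1: a common smooth cover
`Z → X`, `Z → Y` over a base `S`) is transported along a purely inseparable extension of a ground
field (proof of Thm. 4.1.1, Step 2, p. 48: "we extend the field `K` by replacing it with
`L := lK` … we can just replace `Y` and `C` with `Y_l := Nr_l(Y)` and …"; Step 4, p. 49: "replace
`k̄, mᵢ, K, Kᵢ` with `l̄, l̄mᵢ, l̄K, l̄Kᵢ` … `xᵢ` are still smooth-equivalent to `yᵢ` by Lemma 2.8.5
(we can take `Y` for the base scheme `S` in the lemma). In particular, `x₁` is `l`-smooth"):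
the two `l`-structures which the cover `Z` inherits from `X` and from `Y` agree, because they
agree on `k`, `l/k` is purely inseparable and `Z` — smooth over the integral scheme `X` — is
reduced. PROVED here:

* `isReduced_of_smooth_of_isDomain` — a smooth algebra `D` over a domain `A` is reduced: `D` is
  flat, so `D ↪ Frac(A) ⊗_A D`, which is smooth over the field `Frac(A)` and hence reduced
  (`Literature.AlgebraicGeometry.Motives.isReduced_of_smooth_of_field`, `VarietiesGeometricallyIntegralProofs.lean`, Stacks 056T;
  the étale case over a domain is `Literature.AlgebraicGeometry.Motives.isReduced_of_etale_of_isDomain` there).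
* (The companion fact — two ring maps from a purely inseparable extension `l/k` into a REDUCED
  ring which agree on `k` are equal — is Mathlib's `IsPurelyInseparable.injective_comp_algebraMap`.)
* Generic fibres inside a field (`genericFibre` section): for subrings `B ⊆ T` of fields
  `κ = Frac B ⊆ K`, the ring `κ[T]` is the localization of `T` at `B ∖ 0`
  (`isLocalization_adjoin`, `mem_adjoin_iff_exists_div`); hence it is integrally closed in `K`
  when `T` is (`mem_adjoin_of_isIntegral_adjoin`: the generic fibre of a normal model is normal,
  §4.2, Step 2) and integral closure in a bigger field commutes with it
  (`exists_mul_isIntegral_of_isIntegral_map_adjoin`: `Nr_L(X_η) = Nr_L(X)_η`, §4.2, Step 1).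

## Sources

* M. Temkin, *Inseparable local uniformization*, arXiv:0804.1554v3, proof of Thm. 4.1.1, Steps
  2 and 4 (pp. 48–49); Lemma 2.3.9 (i) (p. 15: "If `X` is integral and normal [and `f : Y → X`
  smooth] then `Y` is a finite disjoint union of integral normal schemes" — in particular
  reduced; here only reducedness, over any integral affine base).
* The Stacks Project, Tag 056T (smooth over a field ⇒ geometrically reduced), as proved in
  `Literature/AlgebraicGeometry/Motives/VarietiesGeometricallyIntegralProofs.lean`.

Numbering follows the journal version = arXiv:0804.1554v3 (Definition 2.8.1, Lemmas 2.3.9,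
2.8.5, §4.2); in the earlier arXiv version held in the literature store
(`paper:arxiv-0804.1554`, 41 pp.) these are Definition 2.7.1, Lemmas 2.2.9, 2.7.5, with the
same wording.
-/

noncomputable section

open TensorProduct

namespace Literature.AlgebraicGeometry.Resolution

universe u

/-- **A smooth algebra over a domain is reduced** (the affine, reducedness-only part of Temkin
2013, Lemma 2.3.9 (i): a scheme smooth over an integral scheme is reduced): `D` is flat over the
domain `A` (`Algebra.Smooth.flat`), so `D → Frac(A) ⊗_A D` is injective, and `Frac(A) ⊗_A D` is
smooth over the field `Frac(A)`, hence reduced (`Literature.AlgebraicGeometry.Motives.isReduced_of_smooth_of_field`, Stacks 056T).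
[cite: Temkin2013, Lemma 2.3.9 (i)] -/
theorem isReduced_of_smooth_of_isDomain (A D : Type*) [CommRing A] [IsDomain A] [CommRing D]
    [Algebra A D] [Algebra.Smooth A D] : IsReduced D := by
  let K := FractionRing A
  haveI : IsReduced (K ⊗[A] D) := Literature.AlgebraicGeometry.Motives.isReduced_of_smooth_of_field K (K ⊗[A] D)
  have h1 : Function.Injective ((Algebra.linearMap A K).rTensor D) :=
    Module.Flat.rTensor_preserves_injective_linearMap (M := D) (Algebra.linearMap A K)
      (IsFractionRing.injective A K)
  have key : ∀ z : D, (Algebra.linearMap A K).rTensor D ((TensorProduct.lid A D).symm z) =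
      Algebra.TensorProduct.includeRight (R := A) (A := K) z := fun z => by
    simp [Algebra.TensorProduct.includeRight_apply]
  have hinj : Function.Injective
      (Algebra.TensorProduct.includeRight (R := A) (A := K) (B := D)) := fun x y hxy => by
    apply (TensorProduct.lid A D).symm.injective
    apply h1
    rw [key, key, hxy]
  exact isReduced_of_injective _ hinj

/-! ### Generic fibres of affine models inside a field: `κ[T]` as a localization of `T`

In §4 all schemes are affine and integral inside a field `K ⊇ κ = k̄ = Frac B`; the generic
fibre of `Spec T → Spec B` (`B ⊆ T ⊆ K`) is `Spec(T ⊗_B κ) = Spec κ[T]`, the localization of `T`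
at `B ∖ 0` (Temkin 2013, §4.2, Step 1, p. 50: "`x` is a closed point of `X_η` (where `η` is the
generic point of `Y`)"; Step 2, p. 51: "`X_S = Nr_K(X ×_Y S)` … its `η`-fiber is isomorphic to
`X_η` (we use that `X_η` is normal because `X` is so)"). We set this up as an `IsLocalization`
instance and derive the two facts used there: `κ[T]` is integrally closed in `K` when `T` is, and
integral closure commutes with this localization. -/

section genericFibre

variable {κ K : Type*} [Field κ] [Field K] [Algebra κ K]

/-- The ring `κ[T] ⊆ K` generated by a subring `T ⊆ K` over the subfield `κ` is a `T`-algebra by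
inclusion. [folklore] -/
instance Subring.algebraAdjoinField (T : Subring K) : Algebra T (Algebra.adjoin κ (T : Set K)) :=
  (T.subtype.codRestrict (Algebra.adjoin κ (T : Set K)) fun t => Algebra.subset_adjoin t.2).toAlgebra

/-- The `T`-algebra map of `κ[T]` is the inclusion. [folklore] -/
@[simp] theorem Subring.algebraMap_adjoinField_apply (T : Subring K) (t : T) :
    ((algebraMap T (Algebra.adjoin κ (T : Set K)) t : Algebra.adjoin κ (T : Set K)) : K) = t :=
  rfl

/-- `T → κ[T] → K` is a tower. [folklore] -/
instance Subring.isScalarTower_adjoinField (T : Subring K) :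
    IsScalarTower T (Algebra.adjoin κ (T : Set K)) K :=
  IsScalarTower.of_algebraMap_eq (fun _ => rfl)

/-- The **denominators from the base**: the multiplicative subset of `T` of (images of) non-zero
elements of the base ring `B ⊆ κ`. [folklore] -/
def baseDenominators (B : Subring κ) (T : Subring K) : Submonoid T where
  carrier := {t | ∃ b ∈ B, b ≠ 0 ∧ (t : K) = algebraMap κ K b}
  one_mem' := ⟨1, B.one_mem, one_ne_zero, by simp⟩
  mul_mem' := by
    rintro t t' ⟨b, hb, hb0, ht⟩ ⟨b', hb', hb0', ht'⟩
    exact ⟨b * b', B.mul_mem hb hb', mul_ne_zero hb0 hb0', by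
      rw [Subring.coe_mul, ht, ht', map_mul]⟩

/-- Membership in `baseDenominators`. [folklore] -/
theorem mem_baseDenominators_iff {B : Subring κ} {T : Subring K} {t : T} :
    t ∈ baseDenominators B T ↔ ∃ b ∈ B, b ≠ 0 ∧ (t : K) = algebraMap κ K b :=
  Iff.rfl

/-- Elements of `baseDenominators` are non-zero. [folklore] -/
theorem ne_zero_of_mem_baseDenominators {B : Subring κ} {T : Subring K} {t : T}
    (ht : t ∈ baseDenominators B T) : (t : K) ≠ 0 := by
  obtain ⟨b, -, hb0, h⟩ := ht
  rw [h]
  exact (map_ne_zero _).mpr hb0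

variable (B : Subring κ) (hB : ∀ z : κ, ∃ a ∈ B, ∃ b ∈ B, z = a / b) (T : Subring K)
  (hBT : B.map (algebraMap κ K) ≤ T)
include hB hBT

/-- **Elements of `κ[T]` are fractions `t / b`** with `t ∈ T` and `0 ≠ b ∈ B`, when
`κ = Frac B` and `B ⊆ T` (so that `κ[T] = T ⊗_B κ` is the generic fibre of `Spec T → Spec B`).
[folklore] -/
theorem mem_adjoin_iff_exists_div {x : K} :
    x ∈ Algebra.adjoin κ (T : Set K) ↔ ∃ t ∈ T, ∃ b ∈ B, b ≠ 0 ∧ x = t / algebraMap κ K b := by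
  constructor
  · intro hx
    induction hx using Algebra.adjoin_induction with
    | mem x hx => exact ⟨x, hx, 1, B.one_mem, one_ne_zero, by simp⟩
    | algebraMap c =>
      obtain ⟨a, ha, b, hb, rfl⟩ := hB c
      by_cases hb0 : b = 0
      · refine ⟨0, T.zero_mem, 1, B.one_mem, one_ne_zero, ?_⟩
        simp [hb0]
      · exact ⟨algebraMap κ K a, hBT ⟨a, ha, rfl⟩, b, hb, hb0, by rw [map_div₀]⟩
    | add x y _ _ ihx ihy =>
      obtain ⟨t, ht, b, hb, hb0, rfl⟩ := ihx
      obtain ⟨t', ht', b', hb', hb0', rfl⟩ := ihy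
      refine ⟨t * algebraMap κ K b' + t' * algebraMap κ K b,
        T.add_mem (T.mul_mem ht (hBT ⟨b', hb', rfl⟩)) (T.mul_mem ht' (hBT ⟨b, hb, rfl⟩)),
        b * b', B.mul_mem hb hb', mul_ne_zero hb0 hb0', ?_⟩
      have h1 : algebraMap κ K b ≠ 0 := (map_ne_zero _).mpr hb0
      have h2 : algebraMap κ K b' ≠ 0 := (map_ne_zero _).mpr hb0'
      rw [map_mul]
      field_simp
    | mul x y _ _ ihx ihy =>
      obtain ⟨t, ht, b, hb, hb0, rfl⟩ := ihx
      obtain ⟨t', ht', b', hb', hb0', rfl⟩ := ihy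
      refine ⟨t * t', T.mul_mem ht ht', b * b', B.mul_mem hb hb', mul_ne_zero hb0 hb0', ?_⟩
      rw [map_mul, div_mul_div_comm]
  · rintro ⟨t, ht, b, hb, hb0, rfl⟩
    rw [div_eq_mul_inv, ← map_inv₀]
    exact Subalgebra.mul_mem _ (Algebra.subset_adjoin ht)
      (Subalgebra.algebraMap_mem _ b⁻¹)

/-- **The generic fibre `κ[T]` is the localization of `T` at the denominators from the base**
`B ∖ 0` (`κ = Frac B`, `B ⊆ T ⊆ K`). [folklore] -/
theorem isLocalization_adjoin :
    IsLocalization (baseDenominators B T) (Algebra.adjoin κ (T : Set K)) := by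
  rw [isLocalization_iff]
  refine ⟨?_, ?_, ?_⟩
  · rintro ⟨t, ht⟩
    have ht0 : (t : K) ≠ 0 := ne_zero_of_mem_baseDenominators ht
    refine isUnit_iff_exists_inv.mpr ⟨⟨(t : K)⁻¹, ?_⟩, ?_⟩
    · obtain ⟨b, -, -, htb⟩ := ht
      rw [htb, ← map_inv₀]
      exact Subalgebra.algebraMap_mem _ b⁻¹
    · exact Subtype.ext (mul_inv_cancel₀ ht0)
  · rintro ⟨z, hz⟩
    obtain ⟨t, ht, b, hb, hb0, rfl⟩ := (mem_adjoin_iff_exists_div B hB T hBT).mp hz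
    refine ⟨⟨⟨t, ht⟩, ⟨⟨algebraMap κ K b, hBT ⟨b, hb, rfl⟩⟩, b, hb, hb0, rfl⟩⟩, ?_⟩
    apply Subtype.ext
    change t / algebraMap κ K b * algebraMap κ K b = t
    exact div_mul_cancel₀ t ((map_ne_zero _).mpr hb0)
  · intro x y hxy
    refine ⟨1, ?_⟩
    have : (x : K) = y := congrArg (fun z : Algebra.adjoin κ (T : Set K) => (z : K)) hxy
    rw [Subtype.ext this]

/-- An element of `K` integral over the generic fibre `κ[T]` becomes integral over `T` after
multiplication by a denominator from the base `B ∖ 0` (integral closure commutes with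
localization). [folklore] -/
theorem exists_mul_isIntegral_of_isIntegral_adjoin {x : K}
    (hx : IsIntegral (Algebra.adjoin κ (T : Set K)) x) :
    ∃ b ∈ B, b ≠ 0 ∧ IsIntegral T (algebraMap κ K b * x) := by
  haveI := isLocalization_adjoin B hB T hBT
  obtain ⟨⟨m, hm⟩, hmx⟩ := IsIntegral.exists_multiple_integral_of_isLocalization
    (baseDenominators B T) (Rₘ := Algebra.adjoin κ (T : Set K)) x hx
  obtain ⟨b, hb, hb0, hmb⟩ := hm
  refine ⟨b, hb, hb0, ?_⟩
  rw [← hmb]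
  exact hmx

/-- **`κ[T]` is integrally closed in `K` when `T` is** (normality of the generic fibre of a
normal affine model: "we use that `X_η` is normal because `X` is so", Temkin 2013, §4.2, Step 2,
p. 51): a localization of a subring integrally closed in `K` is integrally closed in `K`.
[folklore] -/
theorem mem_adjoin_of_isIntegral_adjoin (hT : ∀ x : K, IsIntegral T x → x ∈ T) {x : K}
    (hx : IsIntegral (Algebra.adjoin κ (T : Set K)) x) : x ∈ Algebra.adjoin κ (T : Set K) := by
  obtain ⟨b, hb, hb0, hbx⟩ := exists_mul_isIntegral_of_isIntegral_adjoin B hB T hBT hx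
  rw [mem_adjoin_iff_exists_div B hB T hBT]
  refine ⟨algebraMap κ K b * x, hT _ hbx, b, hb, hb0, ?_⟩
  rw [mul_comm, mul_div_assoc, div_self ((map_ne_zero _).mpr hb0), mul_one]

omit hB hBT in
/-- The base inclusion persists after mapping into a bigger field. [folklore] -/
theorem map_le_map_of_map_le {L : Type*} [Field L] [Algebra K L] [Algebra κ L]
    [IsScalarTower κ K L] (hBT : B.map (algebraMap κ K) ≤ T) :
    B.map (algebraMap κ L) ≤ T.map (algebraMap K L) := by
  rintro _ ⟨b, hb, rfl⟩
  exact ⟨algebraMap κ K b, hBT ⟨b, hb, rfl⟩, (IsScalarTower.algebraMap_apply κ K L b).symm⟩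

/-- **Integral closure commutes with passing to the generic fibre**: for a field `L ⊇ K`, an
element of `L` integral over (the image of) `κ[T]` becomes integral over (the image of) `T`
after multiplication by some `0 ≠ b ∈ B`; i.e. `Nr_L(κ[T]) = κ[Nr_L(T)]` (Temkin 2013, §4.2,
Step 1, p. 50: "The latter variety [`Nr_L(X_η)`] is the generic fiber of the projection
`Nr_L(X) → Nr_l(Y)`"). [folklore] -/
theorem exists_mul_isIntegral_of_isIntegral_map_adjoin {L : Type*} [Field L] [Algebra K L]
    [Algebra κ L] [IsScalarTower κ K L] {y : L}
    (hy : IsIntegral ((Algebra.adjoin κ (T : Set K)).map (IsScalarTower.toAlgHom κ K L)) y) :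
    ∃ b ∈ B, b ≠ 0 ∧ IsIntegral (T.map (algebraMap K L)) (algebraMap κ L b * y) := by
  have hmap : (Algebra.adjoin κ (T : Set K)).map (IsScalarTower.toAlgHom κ K L) =
      Algebra.adjoin κ ((T.map (algebraMap K L) : Subring L) : Set L) := by
    rw [← Algebra.adjoin_image]
    rfl
  rw [hmap] at hy
  exact exists_mul_isIntegral_of_isIntegral_adjoin B hB (T.map (algebraMap K L))
    (map_le_map_of_map_le B T hBT) hy

end genericFibre

end Literature.AlgebraicGeometry.Resolution
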